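import Literature.NumberTheory.GaloisRepresentations.InducedSymplectic
import Literature.NumberTheory.GaloisRepresentations.FramedGaloisRepInduce
import HarnessLib

/-!
# Restriction of an induced representation to a subgroup meeting every coset conjugate of `H`
# inside `H`: the totally split case of Mackey's formula (block-diagonal, on the nose)

Topic `Literature/NumberTheory/GaloisRepresentations`.  Theorem-only file (no named fact, no new
notion).  In the matrix form of `Ind_H^G π` (`InducedGaloisRep`: blocks `π̇(rᵢ⁻¹ g rⱼ)` for a transversal
`rᵢ` of `G/φ(H)`), an element `g ∈ G` all of whose conjugates `rᵢ⁻¹ g rᵢ` lie in `φ(H)` acts BLOCK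
DIAGONALLY, with diagonal blocks `π̇(rᵢ⁻¹ g rᵢ)` — literally, no change of frame
(`indMatrix_eq_diagonal_of_forall_conj_mem`; the accepted `indMatrix_apply_map_of_normal` is the case
`φ(H)` normal, `g ∈ φ(H)`).  Hence for a subgroup `D ≤ G` with `rᵢ⁻¹ D rᵢ ⊆ φ(H)` for every `i` — the
TOTALLY SPLIT case of Mackey's decomposition `Res_D Ind_H^G π = ⊕_{D\\G/H} Ind_{D ∩ ˢH}^D πˢ`, in which
every double coset is a single coset and every local induction is trivial — the restriction of
`Ind(π)` to `D` is the block-diagonal representation `d ↦ diag(π̇(rᵢ⁻¹ d rᵢ))ᵢ`, and its trace and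
characteristic polynomials factor accordingly (
`FramedGaloisRep.induce_apply_coe_of_forall_conj_mem`, `FramedGaloisRep.charpoly_induce_of_forall_conj_mem`).
For Galois groups: `D` a decomposition group at a place `λ` of `K` which splits completely in `F`
(every decomposition group above `λ` lies in `Gal(K̄/F)`), `Ind_{Γ_F}^{Γ_K} ρ|_D ≅ ⊕_{u ∣ λ} ρ^{rᵤ}|_D`.

## References

* J.-P. Serre, *Linear representations of finite groups*, GTM 42 (1977), §7.3 Prop. 22 (Mackey's
  restriction formula), §3.3 (matrix form). [SerreLinearRepresentations1977]
* J. Neukirch, *Algebraic Number Theory* (1999), Ch. I §9 (decomposition groups and complete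
  splitting). [NeukirchANT1999]
-/

noncomputable section

open Matrix Field Topology

namespace Literature.NumberTheory.GaloisRepresentations

universe u v

section IndMatrix

variable {H G R : Type*} [Group H] [Group G] {ι : Type*}

/-- **Block-diagonal action of an element all of whose coset conjugates lie in `φ(H)`.**  If
`rᵢ⁻¹ g rᵢ ∈ φ(H)` for every `i`, then `Ind(π)(g) = diag(π̇(rᵢ⁻¹ g rᵢ))ᵢ` on the nose: the block
`(i, j)`, `i ≠ j`, vanishes because `rᵢ⁻¹ g rⱼ = (rᵢ⁻¹ g rᵢ)(rᵢ⁻¹ rⱼ) ∈ φ(H)` would put `rᵢ`, `rⱼ` in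
the same coset. [cite: SerreLinearRepresentations1977, §7.3 Prop. 22] -/
theorem indMatrix_eq_diagonal_of_forall_conj_mem [Zero R] [DecidableEq ι] (φ : H →* G) (π : H → R)
    {r : ι → G} (hr : Function.Injective fun i => (r i : G ⧸ φ.range)) {g : G}
    (hg : ∀ i, (r i)⁻¹ * g * r i ∈ φ.range) :
    indMatrix φ π r g = Matrix.diagonal fun i => dotExtend φ π ((r i)⁻¹ * g * r i) := by
  ext i j
  rw [indMatrix_apply, Matrix.diagonal_apply]
  split_ifs with hij
  · subst hij
    rfl
  · refine dotExtend_of_not_mem φ π fun hmem => hij (hr ?_)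
    change (r i : G ⧸ φ.range) = (r j : G)
    rw [QuotientGroup.eq]
    -- `rᵢ⁻¹ rⱼ = (rᵢ⁻¹ g rᵢ)⁻¹ (rᵢ⁻¹ g rⱼ) ∈ φ(H)`
    have h : (r i)⁻¹ * r j = ((r i)⁻¹ * g * r i)⁻¹ * ((r i)⁻¹ * g * r j) := by group
    rw [h]
    exact φ.range.mul_mem (φ.range.inv_mem (hg i)) hmem

end IndMatrix


section Charpoly

variable {R : Type*} [CommRing R] {o n' : Type*} [Fintype o] [DecidableEq o] [Fintype n'] [DecidableEq n']

/-- The characteristic matrix of a block-diagonal matrix is block diagonal. [folklore] -/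
theorem charmatrix_blockDiagonal (M : o → Matrix n' n' R) :
    Matrix.charmatrix (Matrix.blockDiagonal M) = Matrix.blockDiagonal fun k => Matrix.charmatrix (M k) := by
  ext ⟨i, k⟩ ⟨j, k'⟩
  simp only [Matrix.charmatrix_apply, Matrix.blockDiagonal_apply, Matrix.diagonal_apply, Prod.mk.injEq]
  by_cases hk : k = k'
  · subst hk
    by_cases hij : i = j
    · subst hij; simp
    · simp [hij]
  · simp [hk]

/-- **The characteristic polynomial of a block-diagonal matrix is the product of those of its
blocks.** [folklore] -/
theorem charpoly_blockDiagonal (M : o → Matrix n' n' R) :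
    (Matrix.blockDiagonal M).charpoly = ∏ k, (M k).charpoly := by
  rw [Matrix.charpoly, charmatrix_blockDiagonal, Matrix.det_blockDiagonal]
  rfl

end Charpoly

/-! ### Galois representations: `Ind_{Γ_F}^{Γ_K} ρ` on elements conjugate into `res(Γ_F)` at every coset -/

section Galois

variable (K : Type u) {F : Type v} [Field K] [Field F] [Algebra K F] [CharZero K]
  [FiniteDimensional K F] {A : Type*} [CommRing A] [TopologicalSpace A] {n d : ℕ}

namespace FramedGaloisRep

/-- **`Ind(ρ)(g)` is block diagonal whenever every coset conjugate `rᵢ⁻¹ g rᵢ` of `g` lies in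
`res(Γ_F)`** (e.g. `g` in a decomposition group at a place of `K` that splits completely in `F`):
the matrix of `Ind_{Γ_F}^{Γ_K} ρ (g)` is the flattened block-diagonal matrix of the blocks
`ρ̇(rᵢ⁻¹ g rᵢ)`, for the transversal `rᵢ = absGaloisCosetRep K F hd i` of `induce`.
[cite: SerreLinearRepresentations1977, §7.3 Prop. 22] -/
theorem induce_apply_coe_of_forall_conj_mem (hd : Module.finrank K F = d) (ρ : FramedGaloisRep F A n)
    (g : absoluteGaloisGroup K)
    (hg : ∀ i : Fin d, (absGaloisCosetRep K F hd i)⁻¹ * g * absGaloisCosetRep K F hd i ∈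
      (absGaloisRestrict K F).range) :
    ((ρ.induce K hd g : GL (Fin (d * n)) A) : Matrix (Fin (d * n)) (Fin (d * n)) A) =
      Matrix.reindex finProdFinEquiv finProdFinEquiv
        (Matrix.comp (Fin d) (Fin d) (Fin n) (Fin n) A
          (Matrix.diagonal fun i =>
            dotExtend (absGaloisRestrict K F).toMonoidHom (FramedRep.toMatrixHom ρ)
              ((absGaloisCosetRep K F hd i)⁻¹ * g * absGaloisCosetRep K F hd i))) := by
  rw [induce_def, FramedRep.induce_apply_coe, FramedRep.indFlatHom_apply_eq_reindex]
  congr 2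
  exact indMatrix_eq_diagonal_of_forall_conj_mem _ _ (absGaloisCosetRep_bijective K F hd).1 hg

/-- The diagonal blocks, for `rᵢ⁻¹ g rᵢ = res σᵢ`, are the matrices `ρ(σᵢ)`. [folklore] -/
theorem dotExtend_eq_of_eq_absGaloisRestrict (ρ : FramedGaloisRep F A n) {x : absoluteGaloisGroup K}
    {σ : absoluteGaloisGroup F} (h : x = absGaloisRestrict K F σ) :
    dotExtend (absGaloisRestrict K F).toMonoidHom (FramedRep.toMatrixHom ρ) x =
      ((ρ σ : GL (Fin n) A) : Matrix (Fin n) (Fin n) A) := by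
  rw [h]
  exact dotExtend_absGaloisRestrict K ρ σ

/-- **Characteristic polynomial on a totally split element**: if `rᵢ⁻¹ g rᵢ = res σᵢ` for every
`i`, then `det(X − Ind(ρ)(g)) = ∏ᵢ det(X − ρ(σᵢ))`. [cite: SerreLinearRepresentations1977, §7.3 Prop. 22] -/
theorem charpoly_induce_of_forall_conj_eq (hd : Module.finrank K F = d) (ρ : FramedGaloisRep F A n)
    (g : absoluteGaloisGroup K) (σ : Fin d → absoluteGaloisGroup F)
    (hg : ∀ i : Fin d, (absGaloisCosetRep K F hd i)⁻¹ * g * absGaloisCosetRep K F hd i =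
      absGaloisRestrict K F (σ i)) :
    FramedRep.charpoly (ρ.induce K hd) g = ∏ i, FramedRep.charpoly ρ (σ i) := by
  have hmem : ∀ i : Fin d, (absGaloisCosetRep K F hd i)⁻¹ * g * absGaloisCosetRep K F hd i ∈
      (absGaloisRestrict K F).range := fun i => ⟨σ i, (hg i).symm⟩
  rw [FramedRep.charpoly, induce_apply_coe_of_forall_conj_mem K hd ρ g hmem, Matrix.charpoly_reindex,
    comp_diagonal_eq_reindex_blockDiagonal, Matrix.charpoly_reindex, charpoly_blockDiagonal]
  refine Finset.prod_congr rfl fun i _ => ?_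
  rw [dotExtend_eq_of_eq_absGaloisRestrict K ρ (hg i), FramedRep.charpoly]

/-- And the trace: `tr Ind(ρ)(g) = ∑ᵢ tr ρ(σᵢ)`. [cite: SerreLinearRepresentations1977, §7.2 Prop. 20] -/
theorem trace_induce_of_forall_conj_eq (hd : Module.finrank K F = d) (ρ : FramedGaloisRep F A n)
    (g : absoluteGaloisGroup K) (σ : Fin d → absoluteGaloisGroup F)
    (hg : ∀ i : Fin d, (absGaloisCosetRep K F hd i)⁻¹ * g * absGaloisCosetRep K F hd i =
      absGaloisRestrict K F (σ i)) :
    FramedRep.trace (ρ.induce K hd) g = ∑ i, FramedRep.trace ρ (σ i) := by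
  rw [trace_induce]
  refine Finset.sum_congr rfl fun i _ => ?_
  rw [hg i]
  exact dotExtend_apply_map (absGaloisRestrict_injective K F) _ (σ i)

end FramedGaloisRep

end Galois

end Literature.NumberTheory.GaloisRepresentations

end
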